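import Summits.FinalStateConjecture.FinalStateConjecture.Theorems.SwallowTheDatumParametricKerrBurialStubBulkAtSitesRing
import HarnessLib

/-!
# Stub `stub_bulkAt` of crux `SwallowTheDatum.ParametricKerrBurial` (stmt-FinalStateConjecture-10052), line
# `receding-annulus-universal-collar` — part 2: the CENTRAL site and the END site of the Brill–Lindquist bulk (lead c2)

Central site: the reading at the origin at scale `s₀ = b₀⁻²`, `b₀ = 8 + Nα/L`, is a `C²`-small perturbation of `schwField (2α₀b₀)`,
a Thm-1.7 site against the exact Schwarzschild(`μ′/64`) in-core (`8·(μ′/64) ≤ 2α₀b₀ ≤ m₁`).  End site: far from the cluster the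
conformal factor is `8 + (M/2)/‖y‖ + R` with `R` a first-order source-shift remainder (hypothesis `hSrc` = `stub_bulkCoulombSource`),
so by the Kelvin transport of the sibling lead (hypothesis `hKR` = `UniversalWitnessFamily.stub_kelvinRemainder`) the inverted reading
is `C²`-close to `schwField (8M/X₃)`, a Thm-1.7 site against the sheet-2 far field `schwField (M/X₃)`.  Bricks enter as hypotheses.

References: Brill–Lindquist 1963; Misner–Thorne–Wheeler 1973 §31.7; Mao–Oh–Tao arXiv:2308.13031 Thm 1.7.
-/

set_option linter.dupNamespace false

noncomputable section

-- instance search through the nested operator types `E3 →L E3 →L ℝ` (norms of `iteratedFDeriv`s in `DevLE`)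
set_option maxSynthPendingDepth 3

namespace Summit.FinalStateConjecture.FinalStateConjecture.Theorems.SwallowTheDatum.ParametricKerrBurial

open scoped Manifold ContDiff Topology BigOperators InnerProductSpace
open Bundle Set Filter Function MeasureTheory Literature.Geometry.Lorentzian
open Literature.Geometry.Lorentzian.MaoOhTao Literature.Geometry.Lorentzian.InitialDataSet


/-! ## §1b The central site and the end site -/

/-- **Registered anchor of this support file** (`stub_bulkAtSitesCentreEnd_anchor`): the two masses of the end site, `8M/X₃ =
32ρ₃/M` for `X₃ = (M/2)²/ρ₃`. [folklore] -/
theorem stub_bulkAtSitesCentreEnd_anchor : ∀ (M X₃ ρ₃ : ℝ), 0 < M → 0 < ρ₃ → X₃ = (M / 2) ^ 2 / ρ₃ →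
    8 * M / X₃ = 32 * ρ₃ / M := by
  intro M X₃ ρ₃ hM hρ h
  rw [h]; field_simp; ring

/-- **Central site.** At the central puncture the reading at scale `s₀ = b₀⁻²` satisfies the Thm-1.7 hypothesis block against the exact
Schwarzschild(`μ′/64`) in-core. [folklore] -/
theorem bulkAt_centreSite {η : ℝ → ℝ} {εo μo κ cdev m₁ K C₂ L α₀ α b b₀ μ' : ℝ} {N : ℕ} {ĉ : ℕ → E3}
    {B : InitialDataSet (𝓡 3) E3}
    (hSM : ∀ (mIn mOut : ℝ), 0 ≤ mIn → 8 * mIn ≤ mOut → 0 < mOut → mOut ≤ m₁ →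
      DevLE (schwField mIn) zeroField 1 2 (cdev * mIn) ∧
      ∃ sOut : ℝ, ∀ gOut : E3 → E3 →L[ℝ] E3 →L[ℝ] ℝ,
        ContDiffOn ℝ ∞ gOut {x : E3 | 16 < ‖x‖} →
        DevLE (fun x ↦ gOut x - schwField mOut x + (innerSL ℝ : E3 →L[ℝ] E3 →L[ℝ] ℝ)) zeroField 32 64 (κ * mOut) →
        MOTHyp η εo μo (schwField mIn) zeroField gOut zeroField (cdev * mIn) sOut)
    (hSR : ∀ (b α W : ℝ) (c : E3) (w : E3 → ℝ) (B : InitialDataSet (𝓡 3) E3),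
      0 < b → 0 < α → 2 * α * b ≤ 1 → 0 ≤ W → 256 * W ≤ 1 →
      (∀ y : E3, B.k y = 0) →
      ContDiffOn ℝ ∞ w (Metric.ball c (256 / b ^ 2)) → w c = 0 →
      (∀ m : ℕ, 1 ≤ m → m ≤ 2 → ∀ y ∈ Metric.ball c (256 / b ^ 2),
        ‖iteratedFDeriv ℝ m w y‖ ≤ W * b ^ (2 * m + 1)) →
      (∀ y ∈ Metric.ball c (256 / b ^ 2), 8 / b ^ 2 < ‖y - c‖ →
        B.coordH y = (b + α / ‖y - c‖ + w y) ^ 4 • (innerSL ℝ : E3 →L[ℝ] E3 →L[ℝ] ℝ)) →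
      ∀ yh : E3, 16 ≤ ‖yh‖ → ‖yh‖ ≤ 128 →
        ((b ^ 2)⁻¹) ^ 2 • B.coordK (c + (b ^ 2)⁻¹ • yh) = 0 ∧
        ∀ m : ℕ, m ≤ 2 → ‖iteratedFDeriv ℝ m
          (fun z : E3 ↦ ((b ^ 2)⁻¹) ^ 2 • B.coordH (c + (b ^ 2)⁻¹ • z) - schwField (2 * α * b) z) yh‖
            ≤ K * W)
    (hCoul : ∀ (S : Finset ℕ) (p : ℕ → E3) (wgt d : ℕ → ℝ),
      (∀ i ∈ S, 0 ≤ wgt i) → (∀ i ∈ S, 0 < d i ∧ d i ≤ ‖p i‖) →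
      ∀ w : E3, (∀ i ∈ S, ‖w‖ ≤ d i / 2) →
        |∑ i ∈ S, wgt i * ‖p i + w‖⁻¹ - ∑ i ∈ S, wgt i * ‖p i‖⁻¹| ≤ C₂ * ‖w‖ * ∑ i ∈ S, wgt i / d i ^ 2 ∧
        (∀ m : ℕ, 1 ≤ m → m ≤ 2 →
          ‖iteratedFDeriv ℝ m (fun w : E3 ↦ ∑ i ∈ S, wgt i * ‖p i + w‖⁻¹) w‖ ≤ C₂ * ∑ i ∈ S, wgt i / d i ^ (m + 1)) ∧
        ContDiffAt ℝ ∞ (fun w : E3 ↦ ∑ i ∈ S, wgt i * ‖p i + w‖⁻¹) w)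
    (hN : 4 ≤ N) (hĉ1 : ∀ k : ℕ, ‖ĉ k‖ = 1)
    (hL : 0 < L) (hα₀ : 0 < α₀) (hα : 0 < α) (hb₀ : b₀ = 8 + N * α / L) (hbpos : 0 < b) (hκ : 0 ≤ κ)
    (hC₂ : 0 ≤ C₂)
    (hμ' : 0 < μ') (hm₁ : m₁ ≤ 1) (hmc : 2 * α₀ * b₀ ≤ m₁) (hmc' : μ' / 8 ≤ 2 * α₀ * b₀)
    (hW1 : K * (C₂ * (N * α / (L ^ 2 * b₀ ^ 3) + N * α / (L ^ 3 * b₀ ^ 5))) ≤ κ * (2 * α₀ * b₀))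
    (hW2 : 256 * (C₂ * (N * α / (L ^ 2 * b₀ ^ 3) + N * α / (L ^ 3 * b₀ ^ 5))) ≤ 1)
    (hsep : 256 / b ^ 2 ≤ 2 * L / N) (hsep₀ : 256 / b₀ ^ 2 ≤ L / 2)
    (hBk : ∀ y : E3, B.k y = 0)
    (hBH : ∀ y : E3, (b₀ ^ 2)⁻¹ / 2 < ‖y‖ → (∀ k ∈ Finset.Icc 1 N, (b ^ 2)⁻¹ / 2 < ‖y - L • ĉ k‖) →
      B.coordH y = (8 + α₀ / ‖y‖ + ∑ k ∈ Finset.Icc 1 N, α / ‖y - L • ĉ k‖) ^ 4 •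
        (innerSL ℝ : E3 →L[ℝ] E3 →L[ℝ] ℝ)) :
    DevLE (schwField (μ' / 64)) zeroField 1 2 (cdev * (μ' / 64)) ∧
    ∃ sOut : ℝ,
      MOTHyp η εo μo (schwField (μ' / 64)) zeroField (fun y ↦ ((b₀ ^ 2)⁻¹) ^ 2 • B.coordH (0 + (b₀ ^ 2)⁻¹ • y))
        (fun y ↦ ((b₀ ^ 2)⁻¹) ^ 2 • B.coordK (0 + (b₀ ^ 2)⁻¹ • y)) (cdev * (μ' / 64)) sOut := by
  classical
  have hN0 : (0 : ℝ) < N := by exact_mod_cast (show 0 < N by omega)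
  have hN4' : (4 : ℝ) ≤ N := by exact_mod_cast hN
  have hb₀pos : 0 < b₀ := by
    have : 0 ≤ (N : ℝ) * α / L := by positivity
    rw [hb₀]; linarith
  have hb2 : 0 < b ^ 2 := by positivity
  have hb₀2 : 0 < b₀ ^ 2 := by positivity
  have hLN2 : 2 * L / N ≤ L / 2 := by
    rw [div_le_div_iff₀ hN0 two_pos]; nlinarith
  have hsmall : (b₀ ^ 2)⁻¹ / 2 < 8 / b₀ ^ 2 := by
    rw [inv_eq_one_div, div_div, div_lt_div_iff₀ (by positivity) hb₀2]; nlinarith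
  have hsmallb : (b ^ 2)⁻¹ / 2 < 256 / b ^ 2 := by
    rw [inv_eq_one_div, div_div, div_lt_div_iff₀ (by positivity) hb2]; nlinarith
  -- the site mass window and the site margin
  have hmc0 : 0 < 2 * α₀ * b₀ := by positivity
  obtain ⟨hdev, sOut, hMO⟩ := hSM (μ' / 64) (2 * α₀ * b₀) (by positivity) (by linarith) hmc0 hmc
  refine ⟨hdev, sOut, ?_⟩
  -- the size `W` of the regular-part variation
  obtain ⟨W, hW_def⟩ : ∃ W : ℝ, W = C₂ * (N * α / (L ^ 2 * b₀ ^ 3) + N * α / (L ^ 3 * b₀ ^ 5)) := ⟨_, rfl⟩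
  have hW0 : 0 ≤ W := by rw [hW_def]; positivity
  have hW1' : K * W ≤ κ * (2 * α₀ * b₀) := by rw [hW_def]; exact hW1
  have hW2' : 256 * W ≤ 1 := by rw [hW_def]; exact hW2
  -- the Coulomb data of the site
  obtain ⟨G, hG⟩ : ∃ G : E3 → ℝ, G = fun v ↦ ∑ i ∈ Finset.Icc 1 N, α * ‖-(L • ĉ i) + v‖⁻¹ := ⟨_, rfl⟩
  have hdp : ∀ i ∈ Finset.Icc 1 N, 0 < L ∧ L ≤ ‖-(L • ĉ i)‖ := fun i _ ↦
    ⟨hL, by rw [norm_neg, norm_smul, Real.norm_of_nonneg hL.le, hĉ1, mul_one]⟩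
  have hcard : ((Finset.Icc 1 N).card : ℝ) = N := by
    rw [Nat.card_Icc]; push_cast; ring
  have hsum : ∀ m : ℕ, ∑ i ∈ Finset.Icc 1 N, α / L ^ (m + 1) = N * α / L ^ (m + 1) := by
    intro m
    rw [Finset.sum_const, nsmul_eq_mul, hcard, mul_div_assoc]
  -- the regular part `w` of the conformal factor at the centre
  obtain ⟨w, hw⟩ : ∃ w : E3 → ℝ, w = fun y ↦ G y - N * α / L := ⟨_, rfl⟩
  have hGsum : ∀ y : E3, G y = ∑ k ∈ Finset.Icc 1 N, α / ‖y - L • ĉ k‖ := by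
    intro y
    rw [hG]; dsimp only
    refine Finset.sum_congr rfl fun i _ ↦ ?_
    rw [div_eq_mul_inv, neg_add_eq_sub]
  have hident : ∀ y : E3, 8 + α₀ / ‖y‖ + ∑ k ∈ Finset.Icc 1 N, α / ‖y - L • ĉ k‖ =
      b₀ + α₀ / ‖y - 0‖ + w y := by
    intro y
    rw [hw]; dsimp only
    rw [hGsum y, hb₀, sub_zero]
    ring
  have hw0 : w 0 = 0 := by
    rw [hw]; dsimp only
    rw [hGsum 0, sub_eq_zero]
    have : ∀ k ∈ Finset.Icc 1 N, α / ‖(0 : E3) - L • ĉ k‖ = α / L := fun k _ ↦ by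
      rw [zero_sub, norm_neg, norm_smul, Real.norm_of_nonneg hL.le, hĉ1, mul_one]
    rw [Finset.sum_congr rfl this, Finset.sum_const, nsmul_eq_mul, hcard, mul_div_assoc]
  -- smoothness and derivative bounds of `w` on the reading ball
  have hGat : ∀ y ∈ Metric.ball (0 : E3) (256 / b₀ ^ 2), ContDiffAt ℝ ∞ G y ∧
      ∀ m : ℕ, 1 ≤ m → m ≤ 2 → ‖iteratedFDeriv ℝ m G y‖ ≤ C₂ * ∑ i ∈ Finset.Icc 1 N, α / L ^ (m + 1) := by
    intro y hy
    have hv : ‖y‖ < 256 / b₀ ^ 2 := by rwa [Metric.mem_ball, dist_zero_right] at hy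
    have h := hCoul (Finset.Icc 1 N) (fun i ↦ -(L • ĉ i)) (fun _ ↦ α) (fun _ ↦ L) (fun _ _ ↦ hα.le) hdp y
      (fun _ _ ↦ by linarith [hv.le.trans hsep₀])
    rw [hG]
    exact ⟨h.2.2, h.2.1⟩
  have hwC : ContDiffOn ℝ ∞ w (Metric.ball (0 : E3) (256 / b₀ ^ 2)) := by
    intro y hy
    rw [hw]
    exact ((hGat y hy).1.sub contDiffAt_const).contDiffWithinAt
  have hwb : ∀ m : ℕ, 1 ≤ m → m ≤ 2 → ∀ y ∈ Metric.ball (0 : E3) (256 / b₀ ^ 2),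
      ‖iteratedFDeriv ℝ m w y‖ ≤ W * b₀ ^ (2 * m + 1) := by
    intro m hm1 hm2 y hy
    have hGy := hGat y hy
    have hder : iteratedFDeriv ℝ m w y = iteratedFDeriv ℝ m G y := by
      have e1 : w = G - fun _ ↦ (N * α / L) := by rw [hw]; rfl
      have hGm : ContDiffAt ℝ m G y := hGy.1.of_le (by exact_mod_cast le_top)
      rw [e1, iteratedFDeriv_sub_apply hGm contDiffAt_const, iteratedFDeriv_const_of_ne (by omega), Pi.zero_apply,
        sub_zero]
    rw [hder]
    refine (hGy.2 m hm1 hm2).trans ?_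
    rw [hsum m]
    have hb3 : 0 < b₀ ^ 3 := by positivity
    have hb5 : 0 < b₀ ^ 5 := by positivity
    rcases (show m = 1 ∨ m = 2 by omega) with rfl | rfl
    · have e : C₂ * (N * α / L ^ (1 + 1)) = C₂ * (N * α / (L ^ 2 * b₀ ^ 3)) * b₀ ^ (2 * 1 + 1) := by
        field_simp
      rw [e]
      refine mul_le_mul_of_nonneg_right ?_ hb3.le
      have : 0 ≤ C₂ * (N * α / (L ^ 3 * b₀ ^ 5)) := by positivity
      rw [hW_def, mul_add]; linarith
    · have e : C₂ * (N * α / L ^ (2 + 1)) = C₂ * (N * α / (L ^ 3 * b₀ ^ 5)) * b₀ ^ (2 * 2 + 1) := by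
        field_simp
      rw [e]
      refine mul_le_mul_of_nonneg_right ?_ hb5.le
      have : 0 ≤ C₂ * (N * α / (L ^ 2 * b₀ ^ 3)) := by positivity
      rw [hW_def, mul_add]; linarith
  -- the bulk formula on the reading shell
  have hform : ∀ y ∈ Metric.ball (0 : E3) (256 / b₀ ^ 2), 8 / b₀ ^ 2 < ‖y - 0‖ →
      B.coordH y = (b₀ + α₀ / ‖y - 0‖ + w y) ^ 4 • (innerSL ℝ : E3 →L[ℝ] E3 →L[ℝ] ℝ) := by
    intro y hy h8
    rw [sub_zero] at h8
    have hv : ‖y‖ < 256 / b₀ ^ 2 := by rwa [Metric.mem_ball, dist_zero_right] at hy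
    have hy0 : (b₀ ^ 2)⁻¹ / 2 < ‖y‖ := hsmall.trans h8
    have hyk : ∀ k ∈ Finset.Icc 1 N, (b ^ 2)⁻¹ / 2 < ‖y - L • ĉ k‖ := by
      intro k _
      have htri : L ≤ ‖y - L • ĉ k‖ + ‖y‖ := by
        have : ‖L • ĉ k‖ ≤ ‖y - L • ĉ k‖ + ‖y‖ := by
          calc ‖L • ĉ k‖ = ‖y - (y - L • ĉ k)‖ := by rw [sub_sub_cancel]
            _ ≤ ‖y‖ + ‖y - L • ĉ k‖ := norm_sub_le _ _
            _ = ‖y - L • ĉ k‖ + ‖y‖ := add_comm _ _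
        rwa [norm_smul, Real.norm_of_nonneg hL.le, hĉ1, mul_one] at this
      linarith [hv.le.trans hsep₀, hsep.trans hLN2]
    rw [hBH y hy0 hyk, hident y]
  -- the reading is `K W`-close to `schwField (2α₀b₀)`; feed the site margin
  obtain ⟨gH, hgH⟩ : ∃ gH : E3 → E3 →L[ℝ] E3 →L[ℝ] ℝ,
      gH = fun y ↦ ((b₀ ^ 2)⁻¹) ^ 2 • B.coordH (0 + (b₀ ^ 2)⁻¹ • y) := ⟨_, rfl⟩
  have hread := hSR b₀ α₀ W 0 w B hb₀pos hα₀ (by linarith) hW0 hW2' hBk hwC hw0 hwb hform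
  have hgHs : ContDiffOn ℝ ∞ gH {x : E3 | 16 < ‖x‖} := by
    have h1 : ContDiff ℝ ∞ B.coordH := B.contMDiff_coordH.contDiff
    have h2 : ContDiff ℝ ∞ fun y : E3 ↦ (0 : E3) + (b₀ ^ 2)⁻¹ • y :=
      contDiff_const.add (contDiff_id.const_smul ((b₀ ^ 2)⁻¹))
    rw [hgH]
    exact ((h1.comp h2).const_smul (((b₀ ^ 2)⁻¹) ^ 2)).contDiffOn
  have hclose : DevLE (fun x ↦ gH x - schwField (2 * α₀ * b₀) x + (innerSL ℝ : E3 →L[ℝ] E3 →L[ℝ] ℝ)) zeroField 32 64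
      (κ * (2 * α₀ * b₀)) := by
    intro x hx1 hx2
    refine ⟨fun m hm ↦ ?_, fun m _ ↦ ?_⟩
    · have e1 : (fun y ↦ gH y - schwField (2 * α₀ * b₀) y + (innerSL ℝ : E3 →L[ℝ] E3 →L[ℝ] ℝ) -
          (innerSL ℝ : E3 →L[ℝ] E3 →L[ℝ] ℝ)) =
          fun z ↦ ((b₀ ^ 2)⁻¹) ^ 2 • B.coordH (0 + (b₀ ^ 2)⁻¹ • z) - schwField (2 * α₀ * b₀) z := by
        funext y; rw [hgH, add_sub_cancel_right]
      refine le_trans (le_of_eq ?_) (((hread x (by linarith) (by linarith)).2 m hm).trans hW1')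
      rw [e1]
    · exact norm_iteratedFDeriv_zeroField_le m x (by positivity)
  have hM := hMO gH hgHs hclose
  rw [hgH] at hM
  rw [reading_coordK_eq_zeroField hBk 0 ((b₀ ^ 2)⁻¹) (((b₀ ^ 2)⁻¹) ^ 2)]
  exact hM

/-- **End site.** Through the sheet-2 inversion the bulk reads as a `C²`-small perturbation of `schwField (8M/X₃)`, so the end is a
Thm-1.7 site against the sheet-2 far field `schwField (M/X₃)`. [folklore] -/
theorem bulkAt_endSite {η : ℝ → ℝ} {εo μo κ cdev m₁ K₂ C₃ L α₀ α b b₀ M ρ₃ X₃ : ℝ} {N : ℕ} {ĉ : ℕ → E3}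
    {B : InitialDataSet (𝓡 3) E3}
    (hSM : ∀ (mIn mOut : ℝ), 0 ≤ mIn → 8 * mIn ≤ mOut → 0 < mOut → mOut ≤ m₁ →
      DevLE (schwField mIn) zeroField 1 2 (cdev * mIn) ∧
      ∃ sOut : ℝ, ∀ gOut : E3 → E3 →L[ℝ] E3 →L[ℝ] ℝ,
        ContDiffOn ℝ ∞ gOut {x : E3 | 16 < ‖x‖} →
        DevLE (fun x ↦ gOut x - schwField mOut x + (innerSL ℝ : E3 →L[ℝ] E3 →L[ℝ] ℝ)) zeroField 32 64 (κ * mOut) →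
        MOTHyp η εo μo (schwField mIn) zeroField gOut zeroField (cdev * mIn) sOut)
    (hKR : ∀ (A M ρ₃ X₃ ε : ℝ) (R : E3 → ℝ) (B : InitialDataSet (𝓡 3) E3),
      1 ≤ A → A ≤ 8 → 0 < M → M ≤ X₃ → 0 < ρ₃ → X₃ * ρ₃ = (M / 2) ^ 2 → 0 ≤ ε → ε ≤ 1 →
      (∀ y : E3, B.k y = 0) →
      ContDiffOn ℝ ∞ R {y : E3 | ρ₃ / 512 < ‖y‖ ∧ ‖y‖ < ρ₃ / 4} →
      (∀ m : ℕ, m ≤ 2 → ∀ y : E3, ρ₃ / 512 < ‖y‖ → ‖y‖ < ρ₃ / 4 →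
        ‖iteratedFDeriv ℝ m R y‖ ≤ ε * (M / 2) * ρ₃ ^ 2 / ‖y‖ ^ (m + 3)) →
      (∀ y : E3, ρ₃ / 512 < ‖y‖ → ‖y‖ < ρ₃ / 4 →
        B.coordH y = (A + M / 2 / ‖y‖ + R y) ^ 4 • (innerSL ℝ : E3 →L[ℝ] E3 →L[ℝ] ℝ)) →
      ∀ x : E3, 16 ≤ ‖x‖ → ‖x‖ ≤ 128 →
        invReadK B ρ₃ X₃ x = 0 ∧
        ∀ m : ℕ, m ≤ 2 → ‖iteratedFDeriv ℝ m
          (fun z : E3 ↦ invReadH B ρ₃ X₃ z - schwField (A * M / X₃) z) x‖ ≤ K₂ * ε)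
    (hSrc : ∀ (S : Finset ℕ) (q : ℕ → E3) (ℓ : ℝ) (z : E3), 0 ≤ ℓ → (∀ i ∈ S, ‖q i‖ ≤ ℓ) →
      0 < ‖z‖ → 4 * ℓ ≤ ‖z‖ →
      (∀ m : ℕ, m ≤ 2 →
        ‖iteratedFDeriv ℝ m (fun z : E3 ↦ ∑ i ∈ S, (‖z - q i‖⁻¹ - ‖z‖⁻¹)) z‖ ≤ C₃ * S.card * ℓ / ‖z‖ ^ (m + 2)) ∧
      ContDiffAt ℝ ∞ (fun z : E3 ↦ ∑ i ∈ S, (‖z - q i‖⁻¹ - ‖z‖⁻¹)) z)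
    (hN : 4 ≤ N) (hĉ1 : ∀ k : ℕ, ‖ĉ k‖ = 1)
    (hL : 0 < L) (hα₀ : 0 < α₀) (hα : 0 < α) (hαdef : α = (M / 2 - α₀) / N) (hbpos : 0 < b) (hb₀ : 0 < b₀)
    (hκ : 0 ≤ κ) (hM : 0 < M) (hρ₃ : 0 < ρ₃) (hρM : ρ₃ ≤ M / 80) (hρm : ρ₃ ≤ m₁ * M / 32) (hX₃ : X₃ = (M / 2) ^ 2 / ρ₃)
    (hε1 : C₃ * L / (4 * ρ₃) ≤ 1) (hε2 : K₂ * (C₃ * L / (4 * ρ₃)) ≤ κ * (32 * ρ₃ / M))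
    (hclu : L + 256 / b ^ 2 < ρ₃ / 1024) (hclu₀ : 256 / b₀ ^ 2 < ρ₃ / 1024) (hfar : 4 * L ≤ ρ₃ / 512)
    (hinvC : ContDiffOn ℝ ∞ (invReadH B ρ₃ X₃) {x : E3 | x ≠ 0})
    (hBk : ∀ y : E3, B.k y = 0)
    (hBH : ∀ y : E3, (b₀ ^ 2)⁻¹ / 2 < ‖y‖ → (∀ k ∈ Finset.Icc 1 N, (b ^ 2)⁻¹ / 2 < ‖y - L • ĉ k‖) →
      B.coordH y = (8 + α₀ / ‖y‖ + ∑ k ∈ Finset.Icc 1 N, α / ‖y - L • ĉ k‖) ^ 4 •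
        (innerSL ℝ : E3 →L[ℝ] E3 →L[ℝ] ℝ)) :
    DevLE (schwField (M / X₃)) zeroField 1 2 (cdev * (M / X₃)) ∧
    ∃ sEnd : ℝ, MOTHyp η εo μo (schwField (M / X₃)) zeroField (invReadH B ρ₃ X₃) (invReadK B ρ₃ X₃)
      (cdev * (M / X₃)) sEnd := by
  classical
  have hN0 : (0 : ℝ) < N := by exact_mod_cast (show 0 < N by omega)
  have hX₃pos : 0 < X₃ := by rw [hX₃]; positivity
  have hXρ : X₃ * ρ₃ = (M / 2) ^ 2 := by rw [hX₃]; field_simp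
  have hb2 : 0 < b ^ 2 := by positivity
  have hb₀2 : 0 < b₀ ^ 2 := by positivity
  -- the two masses of the site: `M/X₃ = 4ρ₃/M` (in) and `8M/X₃ = 32ρ₃/M` (out)
  have hmOut : 8 * M / X₃ = 32 * ρ₃ / M := by rw [hX₃]; field_simp; ring
  have hmOut0 : 0 < 8 * M / X₃ := by positivity
  have hmOut1 : 8 * M / X₃ ≤ m₁ := by
    rw [hmOut, div_le_iff₀ hM]; linarith
  obtain ⟨hdev, sEnd, hMO⟩ := hSM (M / X₃) (8 * M / X₃) (by positivity) (le_of_eq (by ring)) hmOut0 hmOut1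
  refine ⟨hdev, sEnd, ?_⟩
  -- the multipole remainder `R` of the bulk far from the cluster
  obtain ⟨R, hR⟩ : ∃ R : E3 → ℝ, R = fun y ↦ α * ∑ i ∈ Finset.Icc 1 N, (‖y - L • ĉ i‖⁻¹ - ‖y‖⁻¹) := ⟨_, rfl⟩
  obtain ⟨ε, hε_def⟩ : ∃ ε : ℝ, ε = C₃ * L / (4 * ρ₃) := ⟨_, rfl⟩
  have hcard : ((Finset.Icc 1 N).card : ℝ) = N := by
    rw [Nat.card_Icc]; push_cast; ring
  have hNα : (N : ℝ) * α = M / 2 - α₀ := by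
    rw [hαdef]; field_simp
  have hq : ∀ i ∈ Finset.Icc 1 N, ‖L • ĉ i‖ ≤ L := fun i _ ↦ by
    rw [norm_smul, Real.norm_of_nonneg hL.le, hĉ1, mul_one]
  have hshell : ∀ y : E3, ρ₃ / 512 < ‖y‖ → 0 < ‖y‖ ∧ 4 * L ≤ ‖y‖ := fun y hy ↦
    ⟨lt_trans (by positivity) hy, by linarith⟩
  have hSrcAt : ∀ y : E3, ρ₃ / 512 < ‖y‖ →
      (∀ m : ℕ, m ≤ 2 → ‖iteratedFDeriv ℝ m (fun z : E3 ↦ ∑ i ∈ Finset.Icc 1 N, (‖z - L • ĉ i‖⁻¹ - ‖z‖⁻¹)) y‖ ≤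
          C₃ * (Finset.Icc 1 N).card * L / ‖y‖ ^ (m + 2)) ∧
        ContDiffAt ℝ ∞ (fun z : E3 ↦ ∑ i ∈ Finset.Icc 1 N, (‖z - L • ĉ i‖⁻¹ - ‖z‖⁻¹)) y := fun y hy ↦
    hSrc (Finset.Icc 1 N) (fun i ↦ L • ĉ i) L y hL.le hq (hshell y hy).1 (hshell y hy).2
  have hC₃0 : 0 ≤ C₃ := by
    -- from the source-shift bound with `m = 0` at a point of the shell: `0 ≤ ‖…‖ ≤ C₃ * N * L / ‖y‖²`
    obtain ⟨y, hy⟩ : ∃ y : E3, ρ₃ / 512 < ‖y‖ := NormedSpace.exists_lt_norm ℝ E3 (ρ₃ / 512)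
    have h := (hSrcAt y hy).1 0 (by norm_num)
    have h' : 0 ≤ C₃ * (Finset.Icc 1 N).card * L / ‖y‖ ^ (0 + 2) := (norm_nonneg _).trans h
    rw [hcard] at h'
    have hpos : 0 < (N : ℝ) * L / ‖y‖ ^ (0 + 2) := by
      have := (hshell y hy).1; positivity
    have e : C₃ * N * L / ‖y‖ ^ (0 + 2) = C₃ * (N * L / ‖y‖ ^ (0 + 2)) := by ring
    rw [e] at h'
    exact (mul_nonneg_iff_of_pos_right hpos).1 h'
  have hε0 : 0 ≤ ε := by rw [hε_def]; positivity
  have hRC : ContDiffOn ℝ ∞ R {y : E3 | ρ₃ / 512 < ‖y‖ ∧ ‖y‖ < ρ₃ / 4} := by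
    intro y hy
    rw [hR]
    exact ((hSrcAt y hy.1).2.const_smul α).contDiffWithinAt
  have hRb : ∀ m : ℕ, m ≤ 2 → ∀ y : E3, ρ₃ / 512 < ‖y‖ → ‖y‖ < ρ₃ / 4 →
      ‖iteratedFDeriv ℝ m R y‖ ≤ ε * (M / 2) * ρ₃ ^ 2 / ‖y‖ ^ (m + 3) := by
    intro m hm y hy1 hy2
    have hy0 := (hshell y hy1).1
    obtain ⟨hb, hc⟩ := hSrcAt y hy1
    have e1 : R = α • fun z : E3 ↦ ∑ i ∈ Finset.Icc 1 N, (‖z - L • ĉ i‖⁻¹ - ‖z‖⁻¹) := by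
      rw [hR]; rfl
    rw [e1, iteratedFDeriv_const_smul_apply (hc.of_le (by exact_mod_cast le_top)), norm_smul,
      Real.norm_of_nonneg hα.le]
    refine (mul_le_mul_of_nonneg_left (hb m hm) hα.le).trans ?_
    rw [hcard]
    -- `α C₃ N L/‖y‖^(m+2) ≤ ε (M/2) ρ₃²/‖y‖^(m+3)` since `Nα ‖y‖ ≤ (M/2)(ρ₃/4)`
    have h1 : (N : ℝ) * α * ‖y‖ ≤ M / 2 * (ρ₃ / 4) := by
      rw [hNα]; nlinarith [hα₀.le]
    have e2 : α * (C₃ * N * L / ‖y‖ ^ (m + 2)) = (N * α * ‖y‖) * (C₃ * L) / ‖y‖ ^ (m + 3) := by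
      rw [pow_succ]; field_simp
      ring
    have e3 : ε * (M / 2) * ρ₃ ^ 2 / ‖y‖ ^ (m + 3) = (M / 2 * (ρ₃ / 4)) * (C₃ * L) / ‖y‖ ^ (m + 3) := by
      rw [hε_def]; field_simp
    rw [e2, e3]
    exact div_le_div_of_nonneg_right (mul_le_mul_of_nonneg_right h1 (by positivity)) (by positivity)
  -- the bulk formula on the shell
  have hform : ∀ y : E3, ρ₃ / 512 < ‖y‖ → ‖y‖ < ρ₃ / 4 →
      B.coordH y = (8 + M / 2 / ‖y‖ + R y) ^ 4 • (innerSL ℝ : E3 →L[ℝ] E3 →L[ℝ] ℝ) := by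
    intro y hy1 hy2
    have hy0 := (hshell y hy1).1
    have hs₀ : (b₀ ^ 2)⁻¹ / 2 < ‖y‖ := by
      have : (b₀ ^ 2)⁻¹ = (256 / b₀ ^ 2) / 256 := by rw [inv_eq_one_div]; field_simp
      rw [this]; linarith
    have hsb : (b ^ 2)⁻¹ / 2 < ρ₃ / 1024 := by
      have : (b ^ 2)⁻¹ = (256 / b ^ 2) / 256 := by rw [inv_eq_one_div]; field_simp
      rw [this]
      have : (0 : ℝ) ≤ 256 / b ^ 2 := by positivity
      linarith
    have hyk : ∀ k ∈ Finset.Icc 1 N, (b ^ 2)⁻¹ / 2 < ‖y - L • ĉ k‖ := by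
      intro k hk
      have htri : ‖y‖ ≤ ‖y - L • ĉ k‖ + L := by
        have : ‖y‖ ≤ ‖y - L • ĉ k‖ + ‖L • ĉ k‖ := norm_le_norm_sub_add y (L • ĉ k)
        linarith [hq k hk]
      have : (0 : ℝ) ≤ 256 / b ^ 2 := by positivity
      linarith
    rw [hBH y hs₀ hyk]
    congr 2
    -- `α₀/‖y‖ + Σ α/‖y − L ĉ_k‖ = (M/2)/‖y‖ + R y`
    rw [hR]; dsimp only
    rw [Finset.mul_sum]
    have e : ∑ k ∈ Finset.Icc 1 N, α / ‖y - L • ĉ k‖ =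
        ∑ k ∈ Finset.Icc 1 N, α * (‖y - L • ĉ k‖⁻¹ - ‖y‖⁻¹) + N * α / ‖y‖ := by
      rw [← hcard, show ((Finset.Icc 1 N).card : ℝ) * α / ‖y‖ = ∑ k ∈ Finset.Icc 1 N, α / ‖y‖ by
        rw [Finset.sum_const, nsmul_eq_mul, mul_div_assoc], ← Finset.sum_add_distrib]
      refine Finset.sum_congr rfl fun k _ ↦ ?_
      rw [div_eq_mul_inv, div_eq_mul_inv]; ring
    rw [e, hNα]
    field_simp
    ring
  -- the Kelvin transport: the inverted reading is `K₂ ε`-close to `schwField (8M/X₃)`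
  have hε1' : ε ≤ 1 := by rw [hε_def]; exact hε1
  have hMX : M ≤ X₃ := by
    rw [hX₃, le_div_iff₀ hρ₃]; nlinarith
  have hread := hKR 8 M ρ₃ X₃ ε R B (by norm_num) le_rfl hM hMX hρ₃ hXρ hε0 hε1' hBk hRC hRb hform
  have hclose : DevLE (fun x ↦ invReadH B ρ₃ X₃ x - schwField (8 * M / X₃) x + (innerSL ℝ : E3 →L[ℝ] E3 →L[ℝ] ℝ))
      zeroField 32 64 (κ * (8 * M / X₃)) := by
    intro x hx1 hx2
    refine ⟨fun m hm ↦ ?_, fun m _ ↦ ?_⟩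
    · have e1 : (fun y ↦ invReadH B ρ₃ X₃ y - schwField (8 * M / X₃) y + (innerSL ℝ : E3 →L[ℝ] E3 →L[ℝ] ℝ) -
          (innerSL ℝ : E3 →L[ℝ] E3 →L[ℝ] ℝ)) =
          fun z ↦ invReadH B ρ₃ X₃ z - schwField (8 * M / X₃) z := by
        funext y; rw [add_sub_cancel_right]
      have hKε : K₂ * ε ≤ κ * (8 * M / X₃) := by rw [hmOut, hε_def]; exact hε2
      refine le_trans (le_of_eq ?_) (((hread x (by linarith) (by linarith)).2 m hm).trans hKε)
      rw [e1]
    · exact norm_iteratedFDeriv_zeroField_le m x (by positivity)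
  have hM := hMO (invReadH B ρ₃ X₃) (hinvC.mono fun x hx ↦ by
    have : (16 : ℝ) < ‖x‖ := hx
    exact norm_pos_iff.1 (by linarith)) hclose
  have e3 : invReadK B ρ₃ X₃ = zeroField := by
    funext x
    unfold invReadK zeroField
    rw [coordK_eq_zero_of_k hBk, ContinuousLinearMap.bilinearComp_zero, smul_zero]
  rw [e3]
  exact hM



end Summit.FinalStateConjecture.FinalStateConjecture.Theorems.SwallowTheDatum.ParametricKerrBurial

end
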